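import Summits.QuantumFields.BalabanUV.T4Continuum.Support.NE3SmoothRightInverseFlat
import Summits.QuantumFields.BalabanUV.T4Continuum.Support.NE3SmoothLiftCurl
import HarnessLib

/-!
# T⁴ programme, node NE3 — route Π, row Π-R, file Π-R♭-4c: THE CORRECTOR IS CURL-FREE — the curl letters of `smoothRightInverse` at `W = 1`
# are those of the lift: `curlSq 1 (R φ) ≤ 4d·(24·8^{d−1})²·M^{d−4}·‖φ‖²`, `curlL1 1 (R φ) ≤ 2d·24·8^{d−1}·M^{d−2}·‖φ‖_ℓ¹`, `M = L^{j+1}`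

NE3 (node U1b) formalisation swarm, leaf seat `b2b-balaban-t4-ne3-formalise-leaf-01` (gen 7); owner GO ρ-g24-3 (4) (`HOME/CLAIMS.log` l.21552).  The right
inverse of Π-R♭-3 is `R φ = A + dPot f` (`A = smoothLift M φ`, `f = interp M univ (framePot L (j+1) A)`); the flat curl of a coboundary vanishes identically
(`curlAt_flat_dPot`), the flat curl is additive, so the two curl letters of Π-R♭-4b (`NE3SmoothLiftCurl`) hold VERBATIM for `R φ` — the ν-letter scaling
`curlSq ≤ C·M^{d−4}·‖φ‖²` WITHOUT `∇φ`.  (The ℓ² and sup letters of the corrector — through `dPot (framePot A) = φ − cpushIter♭ A` and the level-geometric sup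
bound of `framePot` — are Π-R♭-4d.)

CONTENT ([folklore]; 0 sorry; 0 def): `curlAt_flat_dPot` (= 0), `curlAt_flat_add`, `curlAt_flat_smoothRightInverse` (= the lift's), **`curlSq_flat_smoothRightInverse_le`**,
**`curlL1_flat_smoothRightInverse_le`**.

HONEST FRAMING.  Flat kinematics of OUR objects; SHAPE `SmoothLift` NOT yet fully discharged (ℓ²∕sup of the corrector, curved W); (P♮)_W, T-E_w and **NE3 are NOT
proved**; spine PROVED 0∕9; finite T⁴ rung (B)+1 — NOT infinite volume, NOT mass gap, NOT `BetaPertH`, NOT Clay.  PLACEMENT: `Summits/QuantumFields/BalabanUV/`.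
HONEST DEPENDENCY (cell page 1): continuum YM on T⁴ ⇐ BetaPertH ∧ nine spine estimates (0/9 proved); BetaPertH ⇐ (D1) ∧ (D4) ∧ CAP+tail; G-an2-4 gates asym,
D1 and NE2/3/4.
-/

set_option autoImplicit false

open scoped BigOperators Matrix.Norms.L2Operator
open Finset

namespace Summit.QuantumFields.BalabanUV.T4Continuum.NE3SmoothRightInverseCurl

open Literature.MathematicalPhysics.QuantumFieldTheory.Balaban1983to89
open B7Prop1Explicit B7Prop2Explicit
open T4AveragingDeficitWall (curlAt curl curlSq curlL1)
open T4AveragingDeficitWallBoundary (periodBox)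
open BlockAveragePushDirSplit (flat)
open SmoothRefineInterp (interp)
open NE3TangentNoGoWords (dPot)
open NE3TangentFlatStructure (framePot)
open NE3SmoothLiftFlat (smoothLift)
open NE3SmoothRightInverseFlat (smoothRightInverse)
open NE3SmoothLiftCurl (curlAt_flat_eq curlSq_flat_smoothLift_le curlL1_flat_smoothLift_le)

noncomputable section

variable {d : ℕ} {n : Type*} [Fintype n] [DecidableEq n]

/-- **THE FLAT CURL OF A COBOUNDARY VANISHES**: `curlAt 1 (dPot f) x μ ν = 0`. [folklore] -/
theorem curlAt_flat_dPot (f : Site d → Matrix n n ℂ) (x : Site d) (μ ν : Fin d) :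
    curlAt (flat (d := d) (n := n)) (dPot f) x μ ν = 0 := by
  rw [curlAt_flat_eq]
  simp only [dPot, add_right_comm x (e μ) (e ν)]
  abel

/-- The flat curl is additive in the field. [folklore] -/
theorem curlAt_flat_add (A B : Site d → Fin d → Matrix n n ℂ) (x : Site d) (μ ν : Fin d) :
    curlAt (flat (d := d) (n := n)) (A + B) x μ ν = curlAt (flat (d := d) (n := n)) A x μ ν + curlAt (flat (d := d) (n := n)) B x μ ν := by
  simp only [curlAt_flat_eq, Pi.add_apply]
  abel

/-- **THE CURL OF THE RIGHT INVERSE IS THE CURL OF THE LIFT** (the corrector is a coboundary). [folklore] -/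
theorem curlAt_flat_smoothRightInverse (L j : ℕ) (φ : Site d → Fin d → Matrix n n ℂ) (x : Site d) (μ ν : Fin d) :
    curlAt (flat (d := d) (n := n)) (smoothRightInverse L j φ) x μ ν = curlAt (flat (d := d) (n := n)) (smoothLift (L ^ (j + 1)) φ) x μ ν := by
  unfold smoothRightInverse
  rw [curlAt_flat_add, curlAt_flat_dPot, add_zero]

/-- **THE `curlSq` LETTER OF THE RIGHT INVERSE** (`L ≥ 2`, `d ≥ 1`, `M = L^{j+1}`, any `N`):
`curlSq 1 (smoothRightInverse L j φ) (periodBox (M·N)) ≤ 4d·(24·8^{d−1})²·(M^d∕M⁴)·Σ_{z∈periodBox N}Σ_κ ‖φ z κ‖²` — NO `∇φ`. [folklore] -/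
theorem curlSq_flat_smoothRightInverse_le {L : ℕ} (hL : 2 ≤ L) (hd : 1 ≤ d) (j N : ℕ) (φ : Site d → Fin d → Matrix n n ℂ) :
    curlSq (flat (d := d) (n := n)) (smoothRightInverse L j φ) (periodBox (d := d) (L ^ (j + 1) * N))
      ≤ 4 * (d : ℝ) * (24 * (8 : ℝ) ^ (d - 1)) ^ 2 * ((((L ^ (j + 1) : ℕ) : ℝ)) ^ d / (((L ^ (j + 1) : ℕ) : ℝ)) ^ 4)
          * ∑ z ∈ periodBox (d := d) N, ∑ κ : Fin d, ‖φ z κ‖ ^ 2 := by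
  have hM2 : 2 ≤ L ^ (j + 1) := by
    calc 2 ≤ L := hL
      _ = L ^ 1 := (pow_one L).symm
      _ ≤ L ^ (j + 1) := Nat.pow_le_pow_right (by omega) (by omega)
  have heq : curlSq (flat (d := d) (n := n)) (smoothRightInverse L j φ) (periodBox (d := d) (L ^ (j + 1) * N))
      = curlSq (flat (d := d) (n := n)) (smoothLift (L ^ (j + 1)) φ) (periodBox (d := d) (L ^ (j + 1) * N)) := by
    unfold curlSq curl
    simp only [curlAt_flat_smoothRightInverse]
  rw [heq]
  exact curlSq_flat_smoothLift_le hM2 hd N φ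

/-- **THE `curlL1` LETTER OF THE RIGHT INVERSE**: `curlL1 1 (smoothRightInverse L j φ) (periodBox (M·N)) ≤ 2d·24·8^{d−1}·(M^d∕M²)·Σ_zΣ_κ ‖φ z κ‖`. [folklore] -/
theorem curlL1_flat_smoothRightInverse_le {L : ℕ} (hL : 2 ≤ L) (hd : 1 ≤ d) (j N : ℕ) (φ : Site d → Fin d → Matrix n n ℂ) :
    curlL1 (flat (d := d) (n := n)) (smoothRightInverse L j φ) (periodBox (d := d) (L ^ (j + 1) * N))
      ≤ 2 * (d : ℝ) * (24 * (8 : ℝ) ^ (d - 1)) * ((((L ^ (j + 1) : ℕ) : ℝ)) ^ d / (((L ^ (j + 1) : ℕ) : ℝ)) ^ 2)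
          * ∑ z ∈ periodBox (d := d) N, ∑ κ : Fin d, ‖φ z κ‖ := by
  have hM2 : 2 ≤ L ^ (j + 1) := by
    calc 2 ≤ L := hL
      _ = L ^ 1 := (pow_one L).symm
      _ ≤ L ^ (j + 1) := Nat.pow_le_pow_right (by omega) (by omega)
  have heq : curlL1 (flat (d := d) (n := n)) (smoothRightInverse L j φ) (periodBox (d := d) (L ^ (j + 1) * N))
      = curlL1 (flat (d := d) (n := n)) (smoothLift (L ^ (j + 1)) φ) (periodBox (d := d) (L ^ (j + 1) * N)) := by
    unfold curlL1 curl
    simp only [curlAt_flat_smoothRightInverse]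
  rw [heq]
  exact curlL1_flat_smoothLift_le hM2 hd N φ

end

end Summit.QuantumFields.BalabanUV.T4Continuum.NE3SmoothRightInverseCurl
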